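import Literature.Analysis.FluidPDE.PassiveScalarForcedMollified
import Literature.Analysis.FluidPDE.PassiveScalarEnergySobolev
import HarnessLib

/-!
# Renormalised mollified identity for SOURCED weak passive scalars

Analysis/FluidPDE proof-support file (everything proved). The sourced counterpart
(`Torus.IsWeakScalarTransportForcedOn`, `∂ₜθ + u·∇θ = κΔθ + s`) of the bookkeeping half of
`PassiveScalarEnergySobolev`: for a weak solution `θ ∈ L^∞(0,T; L²(T^d))` with datum
`θ₀ ∈ L¹`, source `s ∈ L¹((0,T) × T^d)`, a smooth kernel `k`, `A = θ ⋆ k`, the flux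
`G(τ, x) = ∫ θ(τ,y) (-⟪u(τ,y), ∇k(x-y)⟫ + κ Δk(x-y)) dy`, the mollified source
`S(τ, x) = ∫ s(τ,y) k(x-y) dy` and a globally Lipschitz `C¹` function `β`, for a.e. `t ∈ (0,T)`:

  `∫ β(A(t,x)) dx = ∫ β((θ₀ ⋆ k)(x)) dx + ∫_{(0,t]} ∫ β'(A(τ,x)) (G(τ,x) + S(τ,x)) dx dτ`

(`ae_integral_comp_molInt_eq`; chain rule along the time primitive of
`PassiveScalarForcedMollified.ae_forall_molInt_eq_datum_add_setIntegral_flux`, Fubini), together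
with the joint-measurability lemmas of the sourced class needed downstream (mollified solution,
flux, DiPerna–Lions commutator, renormalised dissipation) and the velocity-slice facts, obtained
from the homogeneous class through the zero solution (`isWeakScalarTransportOn_zero`).
This is the first step of the renormalised energy inequality for steadily sourced scalars over
`L¹ₜḢ¹ₓ` drifts (`PassiveScalarForcedEnergy`), DiPerna–Lions 1989, §II.3.

## References

* R. J. DiPerna, P.-L. Lions, Invent. Math. 98 (1989), 511–547, §II.1, §II.3. [`DiPernaLions1989`]
* P. Bonicatto, G. Ciampa, G. Crippa, J. Evol. Equ. 24 (2024), proof of Thm. 3.3, (3.1).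
  [`BonicattoCiampaCrippa2023`]
-/

noncomputable section

open MeasureTheory TopologicalSpace Set Function Filter Topology Metric ContinuousLinearMap
  UnitAddTorus
open scoped ENNReal NNReal Convolution ContDiff InnerProductSpace

namespace Literature.Analysis.FluidPDE

namespace Torus

variable {d : Type*} [Fintype d]

namespace IsWeakScalarTransportForcedOn

variable {T κ : ℝ} {u : ℝ → UnitAddTorus d → EuclideanSpace ℝ d} {s : ℝ → UnitAddTorus d → ℝ}
  {θ₀ : UnitAddTorus d → ℝ} {θ : ℝ → UnitAddTorus d → ℝ}

/-! ## Velocity slices through the zero solution -/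

/-- The zero scalar is a weak solution of the homogeneous equation for the drift of a sourced
solution (all bounds and the weak identity are trivial); a device transferring the
drift-only lemmas of the homogeneous class. [folklore] -/
theorem isWeakScalarTransportOn_zero (h : IsWeakScalarTransportForcedOn T κ u s θ₀ θ) :
    IsWeakScalarTransportOn T κ u 0 0 := by
  refine ⟨?_, h.aestronglyMeasurable_velocity, ⟨0, ?_⟩, h.lintegral_velocity_lt_top, ?_,
    h.ae_isWeaklyDivFree, fun ψ _ => ?_⟩
  · exact (aestronglyMeasurable_const (b := (0 : ℝ))).congr (Eventually.of_forall fun p => rfl)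
  · exact Eventually.of_forall fun t => by simp
  · simp
  · simp

/-- For a.e. `t ∈ (0,T)` the velocity slice is integrable (sourced class). [folklore] -/
theorem ae_integrable_velocity (h : IsWeakScalarTransportForcedOn T κ u s θ₀ θ) :
    ∀ᵐ t ∂((volume : Measure ℝ).restrict (Ioo 0 T)), Integrable (u t) volume :=
  h.isWeakScalarTransportOn_zero.ae_integrable_velocity

/-- For a.e. `t ∈ (0,T)` the velocity slice is in `L²` (sourced class). [folklore] -/
theorem ae_memLp_two_velocity (h : IsWeakScalarTransportForcedOn T κ u s θ₀ θ) :
    ∀ᵐ t ∂((volume : Measure ℝ).restrict (Ioo 0 T)), MemLp (u t) 2 volume :=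
  h.isWeakScalarTransportOn_zero.ae_memLp_two_velocity

/-- For a.e. `t ∈ (0,T)` the scalar slice is a.e.-strongly measurable (sourced class). [folklore] -/
theorem ae_aestronglyMeasurable_slice (h : IsWeakScalarTransportForcedOn T κ u s θ₀ θ) :
    ∀ᵐ t ∂((volume : Measure ℝ).restrict (Ioo 0 T)), AEStronglyMeasurable (θ t) volume :=
  h.aestronglyMeasurable_uncurry.prodMk_left

/-! ## Joint measurability -/

/-- Joint measurability of the mollified solution `A(τ, x) = ∫ θ(τ,y) k(x-y) dy` (sourced
class). [folklore] -/
theorem aestronglyMeasurable_uncurry_molInt₁ (h : IsWeakScalarTransportForcedOn T κ u s θ₀ θ)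
    {k : UnitAddTorus d → ℝ} (hk : Continuous k) :
    AEStronglyMeasurable (uncurry fun τ x => ∫ y, θ τ y * k (x - y))
      (((volume : Measure ℝ).restrict (Ioo 0 T)).prod volume) := by
  have e : (uncurry fun τ x => ∫ y, θ τ y * k (x - y)) = uncurry fun τ x => ((θ τ) ⋆[lsmul ℝ ℝ] k) x := by
    funext p
    simp only [uncurry, convolution_lsmul, smul_eq_mul]
  rw [e]
  exact FunctionSpaces.Torus.aestronglyMeasurable_uncurry_convolution (lsmul ℝ ℝ) h.aestronglyMeasurable_uncurry hk

/-- Joint measurability of the mollified source `S(τ, x) = ∫ s(τ,y) k(x-y) dy`. [folklore] -/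
theorem aestronglyMeasurable_uncurry_sourceMol (h : IsWeakScalarTransportForcedOn T κ u s θ₀ θ)
    {k : UnitAddTorus d → ℝ} (hk : Continuous k) :
    AEStronglyMeasurable (uncurry fun τ x => ∫ y, s τ y * k (x - y))
      (((volume : Measure ℝ).restrict (Ioo 0 T)).prod volume) := by
  have e : (uncurry fun τ x => ∫ y, s τ y * k (x - y)) = uncurry fun τ x => ((s τ) ⋆[lsmul ℝ ℝ] k) x := by
    funext p
    simp only [uncurry, convolution_lsmul, smul_eq_mul]
  rw [e]
  exact FunctionSpaces.Torus.aestronglyMeasurable_uncurry_convolution (lsmul ℝ ℝ)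
    h.aestronglyMeasurable_uncurry_source hk

/-- Joint measurability of the flux integral `G(τ, x)` (sourced class). [folklore] -/
theorem aestronglyMeasurable_uncurry_flux₁ (h : IsWeakScalarTransportForcedOn T κ u s θ₀ θ)
    {k : UnitAddTorus d → ℝ} (hk : FunctionSpaces.Torus.IsSmooth k) :
    AEStronglyMeasurable (uncurry fun τ x => ∫ y, θ τ y *
      (-⟪u τ y, FunctionSpaces.Torus.gradient k (x - y)⟫_ℝ + κ * FunctionSpaces.Torus.laplacian k (x - y)))
      (((volume : Measure ℝ).restrict (Ioo 0 T)).prod volume) := by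
  set Ψ : (ℝ × UnitAddTorus d) × UnitAddTorus d → ℝ := fun q => θ q.1.1 q.2 *
    (-⟪u q.1.1 q.2, FunctionSpaces.Torus.gradient k (q.1.2 - q.2)⟫_ℝ + κ * FunctionSpaces.Torus.laplacian k (q.1.2 - q.2)) with hΨ
  have hsub : AEStronglyMeasurable (fun q : (ℝ × UnitAddTorus d) × UnitAddTorus d => q.1.2 - q.2)
      ((((volume : Measure ℝ).restrict (Ioo 0 T)).prod volume).prod volume) :=
    (measurable_fst.snd.sub measurable_snd).aestronglyMeasurable
  have hΨm : AEStronglyMeasurable Ψ ((((volume : Measure ℝ).restrict (Ioo 0 T)).prod volume).prod volume) := by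
    refine (FunctionSpaces.Torus.aestronglyMeasurable_comp_fst_snd h.aestronglyMeasurable_uncurry).mul ?_
    refine ((FunctionSpaces.Torus.aestronglyMeasurable_comp_fst_snd h.aestronglyMeasurable_uncurry_velocity).inner
      (hk.gradient.continuous.comp_aestronglyMeasurable hsub)).neg.add ?_
    exact aestronglyMeasurable_const.mul (hk.laplacian.continuous.comp_aestronglyMeasurable hsub)
  have e : (uncurry fun τ x => ∫ y, θ τ y *
      (-⟪u τ y, FunctionSpaces.Torus.gradient k (x - y)⟫_ℝ + κ * FunctionSpaces.Torus.laplacian k (x - y))) =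
      fun p => ∫ y, Ψ (p, y) := by
    funext p
    rfl
  rw [e]
  exact hΨm.integral_prod_right'

/-- Joint measurability of the DiPerna–Lions commutator `r(τ, x)` (sourced class). [folklore] -/
theorem aestronglyMeasurable_uncurry_comm₁ (h : IsWeakScalarTransportForcedOn T κ u s θ₀ θ)
    {k : UnitAddTorus d → ℝ} (hk : FunctionSpaces.Torus.IsSmooth k) :
    AEStronglyMeasurable (uncurry fun τ x => ∫ y, θ τ y *
      ⟪u τ x - u τ y, FunctionSpaces.Torus.gradient k (x - y)⟫_ℝ)
      (((volume : Measure ℝ).restrict (Ioo 0 T)).prod volume) := by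
  set Ψ : (ℝ × UnitAddTorus d) × UnitAddTorus d → ℝ := fun q => θ q.1.1 q.2 *
    ⟪u q.1.1 q.1.2 - u q.1.1 q.2, FunctionSpaces.Torus.gradient k (q.1.2 - q.2)⟫_ℝ with hΨ
  have hsub : AEStronglyMeasurable (fun q : (ℝ × UnitAddTorus d) × UnitAddTorus d => q.1.2 - q.2)
      ((((volume : Measure ℝ).restrict (Ioo 0 T)).prod volume).prod volume) :=
    (measurable_fst.snd.sub measurable_snd).aestronglyMeasurable
  have hΨm : AEStronglyMeasurable Ψ ((((volume : Measure ℝ).restrict (Ioo 0 T)).prod volume).prod volume) := by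
    refine (FunctionSpaces.Torus.aestronglyMeasurable_comp_fst_snd h.aestronglyMeasurable_uncurry).mul ?_
    exact ((FunctionSpaces.Torus.aestronglyMeasurable_comp_fst h.aestronglyMeasurable_uncurry_velocity).sub
      (FunctionSpaces.Torus.aestronglyMeasurable_comp_fst_snd h.aestronglyMeasurable_uncurry_velocity)).inner
      (hk.gradient.continuous.comp_aestronglyMeasurable hsub)
  have e : (uncurry fun τ x => ∫ y, θ τ y * ⟪u τ x - u τ y, FunctionSpaces.Torus.gradient k (x - y)⟫_ℝ) =
      fun p => ∫ y, Ψ (p, y) := by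
    funext p
    rfl
  rw [e]
  exact hΨm.integral_prod_right'

/-- `τ ↦ ∫⁻ |r(τ, x)| dx` is a.e.-measurable on `(0,T)` (sourced class). [folklore] -/
theorem aemeasurable_lintegral_enorm_comm (h : IsWeakScalarTransportForcedOn T κ u s θ₀ θ)
    {k : UnitAddTorus d → ℝ} (hk : FunctionSpaces.Torus.IsSmooth k) :
    AEMeasurable (fun τ => ∫⁻ x, ‖∫ y, θ τ y * ⟪u τ x - u τ y, FunctionSpaces.Torus.gradient k (x - y)⟫_ℝ‖ₑ)
      ((volume : Measure ℝ).restrict (Ioo 0 T)) :=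
  (h.aestronglyMeasurable_uncurry_comm₁ hk).enorm.lintegral_prod_right'

/-- `τ ↦ ∫ w(A(τ,x)) ‖(θ(τ) ⋆ ∇k)(x)‖² dx` is a.e.-strongly measurable on `(0,T)` for a continuous
weight `w` (sourced class). [folklore] -/
theorem aestronglyMeasurable_integral_comp_mul_norm_sq (h : IsWeakScalarTransportForcedOn T κ u s θ₀ θ)
    {k : UnitAddTorus d → ℝ} (hk : FunctionSpaces.Torus.IsSmooth k) {w : ℝ → ℝ} (hw : Continuous w) :
    AEStronglyMeasurable (fun τ => ∫ x, w (∫ y, θ τ y * k (x - y)) *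
      ‖(θ τ ⋆ FunctionSpaces.Torus.gradient k) x‖ ^ 2) ((volume : Measure ℝ).restrict (Ioo 0 T)) := by
  have hm : AEStronglyMeasurable (uncurry fun τ x => w (∫ y, θ τ y * k (x - y)) *
      ‖(θ τ ⋆ FunctionSpaces.Torus.gradient k) x‖ ^ 2) (((volume : Measure ℝ).restrict (Ioo 0 T)).prod volume) :=
    (hw.comp_aestronglyMeasurable (h.aestronglyMeasurable_uncurry_molInt₁ hk.continuous)).mul
      ((continuous_pow 2).comp_aestronglyMeasurable
        (FunctionSpaces.Torus.aestronglyMeasurable_uncurry_convolution (lsmul ℝ ℝ) h.aestronglyMeasurable_uncurry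
          hk.gradient.continuous).norm)
  exact hm.integral_prod_right'

/-! ## Integrability and Fubini for `w(A) · (G + S)` -/

/-- **Integrability of `w(A) · (G + S)` on `(0,T) × T^d`** for a continuous bounded weight `w`
(`|G(τ,x) + S(τ,x)| ≤ bound(τ) ∈ L¹`, sourced class). [folklore] -/
theorem integrable_comp_molInt_mul_flux (h : IsWeakScalarTransportForcedOn T κ u s θ₀ θ) {k : UnitAddTorus d → ℝ}
    (hk : FunctionSpaces.Torus.IsSmooth k) {w : ℝ → ℝ} (hw : Continuous w) {Cw : ℝ} (hCw : ∀ a, |w a| ≤ Cw) :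
    Integrable (fun p : ℝ × UnitAddTorus d => w (∫ y, θ p.1 y * k (p.2 - y)) *
      ((∫ y, θ p.1 y * (-⟪u p.1 y, FunctionSpaces.Torus.gradient k (p.2 - y)⟫_ℝ + κ * FunctionSpaces.Torus.laplacian k (p.2 - y))) +
        ∫ y, s p.1 y * k (p.2 - y)))
      (((volume : Measure ℝ).restrict (Ioo 0 T)).prod volume) := by
  set μT : Measure ℝ := (volume : Measure ℝ).restrict (Ioo 0 T) with hμT
  obtain ⟨bound, hbi, hGb⟩ := h.exists_flux_bound₁ hk
  have hCw0 : 0 ≤ Cw := (abs_nonneg _).trans (hCw 0)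
  have hFm : AEStronglyMeasurable (fun p : ℝ × UnitAddTorus d => w (∫ y, θ p.1 y * k (p.2 - y)) *
      ((∫ y, θ p.1 y * (-⟪u p.1 y, FunctionSpaces.Torus.gradient k (p.2 - y)⟫_ℝ + κ * FunctionSpaces.Torus.laplacian k (p.2 - y))) +
        ∫ y, s p.1 y * k (p.2 - y)))
      (μT.prod volume) :=
    (hw.comp_aestronglyMeasurable (h.aestronglyMeasurable_uncurry_molInt₁ hk.continuous)).mul
      ((h.aestronglyMeasurable_uncurry_flux₁ hk).add (h.aestronglyMeasurable_uncurry_sourceMol hk.continuous))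
  have hBi : Integrable (fun p : ℝ × UnitAddTorus d => Cw * bound p.1 * (1 : ℝ)) (μT.prod volume) :=
    ((hbi.const_mul Cw).mul_prod (integrable_const (1 : ℝ)))
  refine Integrable.mono' (hBi.congr (Eventually.of_forall fun p => mul_one _)) hFm ?_
  have hae : ∀ᵐ τ ∂μT, ∀ x, ‖w (∫ y, θ τ y * k (x - y)) *
      ((∫ y, θ τ y * (-⟪u τ y, FunctionSpaces.Torus.gradient k (x - y)⟫_ℝ + κ * FunctionSpaces.Torus.laplacian k (x - y))) +
        ∫ y, s τ y * k (x - y))‖ ≤ Cw * bound τ := by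
    filter_upwards [hGb] with τ hG x
    rw [norm_mul, Real.norm_eq_abs]
    exact mul_le_mul (hCw _) (hG x) (norm_nonneg _) hCw0
  have := (Measure.quasiMeasurePreserving_fst (μ := μT) (ν := (volume : Measure (UnitAddTorus d)))).ae hae
  filter_upwards [this] with p hp
  exact hp p.2

/-- **Fubini for `w(A) · (G + S)` on `(0, t] × T^d`**, `t < T` (sourced class). [folklore] -/
theorem integral_integral_comp_molInt_mul_flux_swap (h : IsWeakScalarTransportForcedOn T κ u s θ₀ θ)
    {k : UnitAddTorus d → ℝ} (hk : FunctionSpaces.Torus.IsSmooth k) {w : ℝ → ℝ} (hw : Continuous w) {Cw : ℝ}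
    (hCw : ∀ a, |w a| ≤ Cw) {t : ℝ} (ht : t ∈ Ioo 0 T) :
    ∫ x, ∫ τ in Ioc 0 t, w (∫ y, θ τ y * k (x - y)) *
        ((∫ y, θ τ y * (-⟪u τ y, FunctionSpaces.Torus.gradient k (x - y)⟫_ℝ + κ * FunctionSpaces.Torus.laplacian k (x - y))) +
          ∫ y, s τ y * k (x - y)) =
      ∫ τ in Ioc 0 t, ∫ x, w (∫ y, θ τ y * k (x - y)) *
        ((∫ y, θ τ y * (-⟪u τ y, FunctionSpaces.Torus.gradient k (x - y)⟫_ℝ + κ * FunctionSpaces.Torus.laplacian k (x - y))) +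
          ∫ y, s τ y * k (x - y)) := by
  have hsub : Ioc 0 t ⊆ Ioo 0 T := Ioc_subset_Ioo_right ht.2
  have hle : (volume : Measure ℝ).restrict (Ioc 0 t) ≤ (volume : Measure ℝ).restrict (Ioo 0 T) :=
    Measure.restrict_mono_set _ hsub
  have hFi := (h.integrable_comp_molInt_mul_flux hk hw hCw).mono_measure (Measure.prod_mono hle le_rfl)
  exact integral_integral_swap (μ := (volume : Measure (UnitAddTorus d)))
    (ν := (volume : Measure ℝ).restrict (Ioc 0 t))
    (f := fun x τ => w (∫ y, θ τ y * k (x - y)) *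
      ((∫ y, θ τ y * (-⟪u τ y, FunctionSpaces.Torus.gradient k (x - y)⟫_ℝ + κ * FunctionSpaces.Torus.laplacian k (x - y))) +
        ∫ y, s τ y * k (x - y))) hFi.swap

/-! ## The renormalised mollified identity with datum and source, a.e. in time -/

/-- **The renormalised mollified identity with datum and source** (DiPerna–Lions 1989, §II.3,
integrated form, a.e. in time; sourced equation): for `θ₀ ∈ L¹`, a smooth kernel `k`,
`A(t) = θ(t) ⋆ k`, the flux `G`, the mollified source `S` and a globally Lipschitz `C¹`
function `β`, for a.e. `t ∈ (0,T)`: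
`∫ β(A(t,x)) dx = ∫ β((θ₀ ⋆ k)(x)) dx + ∫_{(0,t]} ∫ β'(A(τ,x)) (G(τ,x) + S(τ,x)) dx dτ`.
[cite: DiPernaLions1989, §II.3] -/
theorem ae_integral_comp_molInt_eq (h : IsWeakScalarTransportForcedOn T κ u s θ₀ θ)
    (hθ₀ : Integrable θ₀ volume) {k : UnitAddTorus d → ℝ} (hk : FunctionSpaces.Torus.IsSmooth k)
    {β : ℝ → ℝ} (hβ : ContDiff ℝ 1 β) {K : NNReal} (hβK : LipschitzWith K β) :
    ∀ᵐ t ∂(volume.restrict (Ioo 0 T)),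
      ∫ x, β (∫ y, θ t y * k (x - y)) = (∫ x, β (∫ y, θ₀ y * k (x - y))) +
        ∫ τ in Ioc 0 t, ∫ x, deriv β (∫ y, θ τ y * k (x - y)) *
          ((∫ y, θ τ y * (-⟪u τ y, FunctionSpaces.Torus.gradient k (x - y)⟫_ℝ + κ * FunctionSpaces.Torus.laplacian k (x - y))) +
            ∫ y, s τ y * k (x - y)) := by
  -- the weight `β'` is continuous and bounded by `K`
  have hβ'c : Continuous (deriv β) := hβ.continuous_deriv le_rfl
  have hβ'b : ∀ a, |deriv β a| ≤ K := fun a => by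
    rw [← Real.norm_eq_abs]; exact norm_deriv_le_of_lipschitz hβK
  filter_upwards [h.ae_forall_molInt_eq_datum_add_setIntegral_flux hθ₀ hk,
    ae_restrict_mem measurableSet_Ioo] with t hAt htT
  have hsub : Ioc 0 t ⊆ Ioo 0 T := Ioc_subset_Ioo_right htT.2
  have hkc : ∀ x : UnitAddTorus d, Continuous fun y : UnitAddTorus d => k (x - y) := fun x =>
    hk.continuous.comp (continuous_const.sub continuous_id)
  -- Step 1: pointwise in `x`
  have hpt : ∀ x, β (∫ y, θ t y * k (x - y)) = β (∫ y, θ₀ y * k (x - y)) +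
      ∫ τ in Ioc 0 t, deriv β (∫ y, θ τ y * k (x - y)) *
        ((∫ y, θ τ y * (-⟪u τ y, FunctionSpaces.Torus.gradient k (x - y)⟫_ℝ + κ * FunctionSpaces.Torus.laplacian k (x - y))) +
          ∫ y, s τ y * k (x - y)) := by
    intro x
    have hGx : IntegrableOn (fun τ => (∫ y, θ τ y *
        (-⟪u τ y, FunctionSpaces.Torus.gradient k (x - y)⟫_ℝ + κ * FunctionSpaces.Torus.laplacian k (x - y))) +
        ∫ y, s τ y * k (x - y)) (Ioo 0 T) volume :=
      (h.integrable_mul_flux hk x).integral_prod_left.add (h.integrable_source_mul_continuous (hkc x)).integral_prod_left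
    rw [hAt x, Calculus.comp_const_add_setIntegral_eq htT.1.le (hGx.mono_set hsub) hβ hβK]
    congr 1
    refine integral_congr_ae ?_
    filter_upwards [ae_restrict_of_ae_restrict_of_subset hsub
      (h.ae_molInt_eq_datum_add_setIntegral_flux hk x)] with τ hτ
    rw [hτ]
  -- Step 2: integrate in `x` and swap
  have hconv : ∀ {δ : UnitAddTorus d → ℝ}, Integrable δ volume → Continuous fun x => ∫ y, δ y * k (x - y) := by
    intro δ hδ
    have e : (fun x => ∫ y, δ y * k (x - y)) = δ ⋆ k := by
      funext x; simp only [convolution_lsmul, smul_eq_mul]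
    rw [e]
    exact FunctionSpaces.Torus.continuous_convolution hδ hk.continuous
  have i0 : Integrable (fun x => β (∫ y, θ₀ y * k (x - y))) volume :=
    (hβ.continuous.comp (hconv hθ₀)).integrable_unitAddTorus
  have hI : Integrable (fun x => ∫ τ in Ioc 0 t, deriv β (∫ y, θ τ y * k (x - y)) *
      ((∫ y, θ τ y * (-⟪u τ y, FunctionSpaces.Torus.gradient k (x - y)⟫_ℝ + κ * FunctionSpaces.Torus.laplacian k (x - y))) +
        ∫ y, s τ y * k (x - y))) volume := by
    have hle : (volume : Measure ℝ).restrict (Ioc 0 t) ≤ (volume : Measure ℝ).restrict (Ioo 0 T) :=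
      Measure.restrict_mono_set _ hsub
    have hFi := (h.integrable_comp_molInt_mul_flux hk hβ'c hβ'b).mono_measure (Measure.prod_mono hle le_rfl)
    exact hFi.swap.integral_prod_left
  simp_rw [hpt]
  rw [integral_add i0 hI, h.integral_integral_comp_molInt_mul_flux_swap hk hβ'c hβ'b htT]

end IsWeakScalarTransportForcedOn

end Torus

end Literature.Analysis.FluidPDE
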